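import Summits.QuantumFields.YangMills.Theorems.IR.BlockedActivityWStrongCouplingMeshes
import Summits.QuantumFields.YangMills.Theorems.IR.BlockedActivityWKRInfluence
import HarnessLib

/-!
# Crux `IR` (stmt-QuantumFields-19354), lane B «strong coupling AFTER BLOCKING»: the class of record at EVERY mesh from ANY two-exterior
# influence bound on the link ratio, and the every-group rows on the SHARP Dobrushin window `18·N·|β| < 1`

Helper module for item `stmt-QuantumFields-19354` (`--supports`; it closes nothing), lane `ym-19354-onsetsc-p2` (g5).

WHAT IS HERE.  The g3 chain of `Theorems/IR/BlockedActivityWStrongCouplingMesh` (one-link change of exterior → telescoping over the `≤ 64 b⁴` centre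
links → multiplicative oscillation of the centre-conditioned boundary ratio → class W by `blockedActivityClassW_of_centreRatio_le`) is re-run
PARAMETRICALLY in its single analytic input — a two-exterior influence bound `ι` for the inner-kernel average of the one-link Boltzmann ratio
`linkRatio` under exteriors agreeing within sup-distance `2nb` of the updated centre link (§1):

* `inner_integral_update_le_of_influence` (step factor `exp(e^{12N|β|} · ι)`), `inner_integral_switch_le_of_influence`,
  `centreRatio_le_exp_of_influence` (oscillation `exp(64 b⁴ e^{12N|β|} ι)`), ★ `blockedActivityClassW_of_influence`
  (`BlockedActivityClassW r.ρ β b n (exp(64 b⁴ e^{12N|β|} ι) − 1)`), `ratioClauseI_of_influence`.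

§2 feeds it with the SHARP every-group door of `Theorems/IR/BlockedActivityWKRInfluence` (`abs_kerInt_sub_le_of_agree_ball_sharp`):

* ★ `blockedActivityClassW_strongCoupling_mesh_sharp` — for every compact `G`, every lattice representation `r` (`N = r.N`), every `β, q` with
  `18·N·|β| ≤ q`, `0 < q < 1`, every mesh `b ≥ 1` and window `n ≥ 1`: `BlockedActivityClassW r.ρ β b n (meshRadiusKR r.N β q b n)`,
  `meshRadiusKR N β q b n = exp(3072 · b⁴ · e^{24N|β|} · q^{2nb}) − 1` (g3's `meshRadiusSC` is the case `q = 1/2`, there at `216N|β| ≤ 1`;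
  here `q = 1/2` needs only `36N|β| ≤ 1`: `blockedActivityClassW_strongCoupling_mesh_36`); `blockedActivityTypWAll_…_sharp` (every `Typ`);
  `ratioClauseI_strongCoupling_sharp`.

The eventually-in-the-mesh ∕ cofinality rows and the certified digit `(32, 1, a⋆)` on `36·N·|β| ≤ 1` are in `Theorems/IR/BlockedActivityWStrongCouplingKRRows`;
the `SU(2)` rows on the Kantorovich window `β_W < 2/9` (Frobenius-Lipschitz link ratio) are in `Theorems/IR/BlockedActivityWStrongCouplingSU2`.

HONEST FRAMING: a strong-coupling (Dobrushin-uniqueness) calibration of the lane's currency of record at every mesh; nothing about weak coupling,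
the onset, a gap or Clay.  No `sorry`; axioms ⊆ {propext, Classical.choice, Quot.sound}; no instances, no notation.
Refs: Dobrushin 1970 Thm. 3; Georgii 2011 Thm. 8.20; Simon CMP 68 (1979); FriedliVelenik2017 §5.7.1; Dobrushin–Shlosman 1987.
-/

set_option autoImplicit false

noncomputable section

open MeasureTheory ProbabilityTheory
open Literature.MathematicalPhysics.QuantumLattice
open Literature.Probability.LatticeModels
open Summit.QuantumFields.YangMills.Cruxes.IR.Tempered (cellEdges windowCells regionEdges collarEdges)
open Summit.QuantumFields.YangMills.Cruxes.IR.CellTempered.Engine (frameCell frameCell_eq_iff mem_cellEdges_frameCell frame_hC1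
  frame_add_nat_le shiftFrame shiftFrame_mesh)
open Summit.QuantumFields.YangMills.Cruxes.IR.OnsetFormats (UnivShellCond)
open Summit.QuantumFields.YangMills.Cruxes.IR.OnsetFormatsUc (TypShellCondUKPc typShellCondUKPc_of_univShellCond)

namespace Summit.QuantumFields.YangMills.Cruxes.IR.BlockedActivity

/-! ## §1 The chain, parametrically in a two-exterior influence bound for the link ratio -/

section Step

variable (G : Type) [Group G] [TopologicalSpace G] [IsTopologicalGroup G] [CompactSpace G] [MeasurableSpace G] [BorelSpace G]
  (r : Literature.MathematicalPhysics.QuantumFieldTheory.LatticeRep G)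
  {β : ℝ} {w : Fin 4 → ℤ → ℤ} {b n : ℕ} {Y : Finset Cell} {σ τ : LGConfig 4 G}

/-- **The one-step ratio bound from an influence bound.**  On a mesh-`b` frame (`b ≥ 1`), window `n ≥ 1`, for `σ` in the agreement class of
`τ`, an exterior `ζ = τ` off the region, a centre link `a` and `x : G`: IF the inner-kernel averages of the one-link ratio `E = linkRatio … a x`
under any two exteriors agreeing on the exterior links within sup-distance `2nb` of `a` differ by at most `ι ≥ 0`, THEN updating `ζ` at `a`
multiplies the inner-kernel average of the boundary ratio by at most `exp(e^{12N|β|} · ι)`.  (g3's `inner_integral_update_le` is the case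
`ι = 48 e^{12N|β|} 2^{−2nb}` supplied by the NT engine at `216N|β| ≤ 1`.) -/
theorem inner_integral_update_le_of_influence (hw : AfPincerUc.IsFrame b w) (hb : 1 ≤ b) (hn : 1 ≤ n)
    (hσ : σ ∈ WindowAgree w n Y τ) {ζ : LGConfig 4 G} (hζ : ∀ e ∉ regionEdges w Y, ζ e = τ e)
    {a : ZdEdge 4} (ha : a ∈ cellEdges w 0) (x : G) {ι : ℝ} (hι : 0 ≤ ι)
    (hinfl : ∀ ω η : LGConfig 4 G, (∀ z : ZdEdge 4, z ∉ innerEdges w Y → ⌊‖z.1 - a.1‖⌋₊ ≤ 2 * n * b → ω z = η z) →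
      |(∫ V, linkRatio r.ρ β w Y a x V ∂(ymSpecification r.ρ β (innerEdges w Y) ω)) -
          ∫ V, linkRatio r.ρ β w Y a x V ∂(ymSpecification r.ρ β (innerEdges w Y) η)| ≤ ι) :
    ∫ V, bcRatio r.ρ β (regionEdges w Y) σ τ V ∂(ymSpecification r.ρ β (innerEdges w Y) (Function.update ζ a x)) ≤
      Real.exp (Real.exp (12 * r.N * |β|) * ι) *
        ∫ V, bcRatio r.ρ β (regionEdges w Y) σ τ V ∂(ymSpecification r.ρ β (innerEdges w Y) ζ) := by
  haveI := r.t2Space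
  haveI := r.secondCountableTopology
  have hρ := r.continuous
  have hγ := Literature.MathematicalPhysics.QuantumFieldTheory.isSpecification_ymSpecification_of_t2Space (d := 4) r.ρ hρ β
  set Λ := regionEdges w Y with hΛ
  set Λ' := innerEdges w Y with hΛ'
  set Φ := bcRatio r.ρ β Λ σ τ with hΦ
  set E := linkRatio r.ρ β w Y a x with hE
  set ζσ := splice Λ ζ σ with hζσ
  haveI := hγ.isProbability Λ' ζ
  haveI := hγ.isProbability Λ' ζσ
  have haΛ' : a ∉ Λ' := not_mem_innerEdges_of_mem_cellEdges w Y ha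
  have hΦm : Measurable Φ := measurable_bcRatio r.ρ hρ β Λ σ τ
  have hEm : Measurable E := by
    refine (Real.continuous_exp.comp (continuous_const.mul ?_)).measurable
    exact ((continuous_wilsonBoundaryAction r.ρ hρ Λ').comp (continuous_id.update a continuous_const)).sub
      (continuous_wilsonBoundaryAction r.ρ hρ Λ')
  set c : ℝ := 12 * r.N * |β| with hc
  have hEb : ∀ V, Real.exp (-c) ≤ E V ∧ E V ≤ Real.exp c := fun V => linkRatio_bounds G r a x V
  -- (1) one-link change of exterior: `∫ Φ dγ(ζ^{a←x}) = ∫ Φ E dγ(ζ) / ∫ E dγ(ζ)`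
  have h1 : ∫ V, Φ V ∂(ymSpecification r.ρ β Λ' (Function.update ζ a x)) =
      (∫ V, Φ V * E V ∂(ymSpecification r.ρ β Λ' ζ)) / ∫ V, E V ∂(ymSpecification r.ρ β Λ' ζ) :=
    integral_ymSpecification_update_eq r.ρ hρ β Λ' ζ haΛ' x hΦm fun V => bcRatio_update_centre r.ρ hw hb hn hσ β ha V x
  -- (2) change of exterior on the inner volume: `∫ E dγ(ζσ) = ∫ E Φ' dγ(ζ) / ∫ Φ' dγ(ζ)` and `Φ' = Φ` a.e.
  have h2 : ∫ V, E V ∂(ymSpecification r.ρ β Λ' ζσ) =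
      (∫ V, E V * Φ V ∂(ymSpecification r.ρ β Λ' ζ)) / ∫ V, Φ V ∂(ymSpecification r.ρ β Λ' ζ) := by
    rw [integral_ymSpecification_eq_div_bcRatio r.ρ hρ β Λ' ζσ ζ hEm
      (fun u => linkRatio_glueWith_eq r.ρ hw hb hn hσ β hζ ha x u)]
    have hae : ∀ᵐ V ∂(ymSpecification r.ρ β Λ' ζ), bcRatio r.ρ β Λ' ζσ ζ V = Φ V := by
      filter_upwards [hγ.proper Λ' ζ] with V hV
      exact (bcRatio_region_eq_inner r.ρ hw hb hn hσ β hζ hV).symm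
    rw [integral_congr_ae (hae.mono fun V hV => by rw [hV] : ∀ᵐ V ∂(ymSpecification r.ρ β Λ' ζ),
      E V * bcRatio r.ρ β Λ' ζσ ζ V = E V * Φ V), integral_congr_ae hae]
  -- positivity
  have hJpos : 0 < ∫ V, Φ V ∂(ymSpecification r.ρ β Λ' ζ) := by
    have := centreRatio_pos (ρ := r.ρ) hρ β w Y σ τ ζ
    simp only [centreRatio, ← hΛ, ← hΛ', splice_eq_self Λ hζ] at this
    exact this
  have hEint : ∀ η : LGConfig 4 G, Real.exp (-c) ≤ ∫ V, E V ∂(ymSpecification r.ρ β Λ' η) := fun η => by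
    haveI := hγ.isProbability Λ' η
    have hi : Integrable E (ymSpecification r.ρ β Λ' η) := Integrable.of_bound hEm.aestronglyMeasurable (Real.exp c)
      (ae_of_all _ fun V => by rw [Real.norm_eq_abs, abs_of_pos ((Real.exp_pos _).trans_le (hEb V).1)]; exact (hEb V).2)
    have := integral_mono (integrable_const (Real.exp (-c))) hi fun V => (hEb V).1
    simpa using this
  have hEpos : 0 < ∫ V, E V ∂(ymSpecification r.ρ β Λ' ζ) := (Real.exp_pos _).trans_le (hEint ζ)
  -- (3) the ratio of the two steps
  have h3 : ∫ V, Φ V ∂(ymSpecification r.ρ β Λ' (Function.update ζ a x)) =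
      (∫ V, Φ V ∂(ymSpecification r.ρ β Λ' ζ)) * ((∫ V, E V ∂(ymSpecification r.ρ β Λ' ζσ)) / ∫ V, E V ∂(ymSpecification r.ρ β Λ' ζ)) := by
    rw [h1, h2]
    have : (fun V => Φ V * E V) = fun V => E V * Φ V := funext fun V => mul_comm _ _
    rw [this]
    field_simp
  -- (4) the influence hypothesis: the two exteriors differ only off the window, at sup-distance `> 2nb` from `a`
  have hagree : ∀ z : ZdEdge 4, z ∉ Λ' → ⌊‖z.1 - a.1‖⌋₊ ≤ 2 * n * b → ζσ z = ζ z := by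
    intro z hz hdist
    by_cases hzΛ : z ∈ Λ
    · exact splice_apply_mem _ _ _ hzΛ
    · rw [hζσ, splice_apply_not_mem _ _ _ hzΛ, hζ z hzΛ]
      have hzw : z ∈ regionEdges w (windowCells n) := by
        by_contra hzw
        have hya : ∀ k, w k 0 ≤ a.1 k ∧ a.1 k < w k 1 := by
          have := ha
          simp only [Summit.QuantumFields.YangMills.Cruxes.IR.Tempered.cellEdges, Finset.mem_product, Fintype.mem_piFinset,
            Finset.mem_Ico, Pi.zero_apply, zero_add] at this
          exact this.1
        have := far_of_not_mem_windowRegion hw hb hzw hya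
        omega
      exact eq_of_mem_windowAgree hσ hzw hzΛ
  have h4 : |(∫ V, E V ∂(ymSpecification r.ρ β Λ' ζσ)) - ∫ V, E V ∂(ymSpecification r.ρ β Λ' ζ)| ≤ ι := hinfl ζσ ζ hagree
  -- (5) assemble: the step ratio is `≤ 1 + e^{c} ι ≤ exp(e^{c} ι)`
  have hstep : (∫ V, E V ∂(ymSpecification r.ρ β Λ' ζσ)) / ∫ V, E V ∂(ymSpecification r.ρ β Λ' ζ) ≤
      Real.exp (Real.exp c * ι) := by
    rw [div_le_iff₀ hEpos]
    have hnum : ∫ V, E V ∂(ymSpecification r.ρ β Λ' ζσ) ≤ ∫ V, E V ∂(ymSpecification r.ρ β Λ' ζ) + ι := by linarith [(abs_le.1 h4).2]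
    have hden := hEint ζ
    have hkey : ι ≤ (Real.exp c * ι) * ∫ V, E V ∂(ymSpecification r.ρ β Λ' ζ) := by
      have hcc : Real.exp c * Real.exp (-c) = 1 := by rw [← Real.exp_add, add_neg_cancel, Real.exp_zero]
      calc ι = (Real.exp c * ι) * Real.exp (-c) := by
            rw [show Real.exp c * ι * Real.exp (-c) = ι * (Real.exp c * Real.exp (-c)) by ring, hcc, mul_one]
        _ ≤ (Real.exp c * ι) * ∫ V, E V ∂(ymSpecification r.ρ β Λ' ζ) := mul_le_mul_of_nonneg_left hden (by positivity)
    have hx := Real.add_one_le_exp (Real.exp c * ι)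
    nlinarith [hEpos]
  rw [h3, mul_comm]
  exact mul_le_mul_of_nonneg_right hstep hJpos.le

/-- **Telescoping over the centre links, from an influence bound `ι` uniform over the centre links and the updates.**  Switching the centre links of
the exterior from `U` to `U'` on a set `D` of centre links multiplies the inner-kernel average of the boundary ratio by at most `exp(#D · e^{12N|β|} ι)`. -/
theorem inner_integral_switch_le_of_influence (hw : AfPincerUc.IsFrame b w) (hb : 1 ≤ b) (hn : 1 ≤ n)
    (hY : cellEdges w 0 ⊆ regionEdges w Y) (hσ : σ ∈ WindowAgree w n Y τ) {ι : ℝ} (hι : 0 ≤ ι)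
    (hinfl : ∀ a ∈ cellEdges w 0, ∀ x : G, ∀ ω η : LGConfig 4 G,
      (∀ z : ZdEdge 4, z ∉ innerEdges w Y → ⌊‖z.1 - a.1‖⌋₊ ≤ 2 * n * b → ω z = η z) →
      |(∫ V, linkRatio r.ρ β w Y a x V ∂(ymSpecification r.ρ β (innerEdges w Y) ω)) -
          ∫ V, linkRatio r.ρ β w Y a x V ∂(ymSpecification r.ρ β (innerEdges w Y) η)| ≤ ι)
    (U U' : LGConfig 4 G) (D : Finset (ZdEdge 4)) (hD : D ⊆ cellEdges w 0) :
    ∫ V, bcRatio r.ρ β (regionEdges w Y) σ τ V ∂(ymSpecification r.ρ β (innerEdges w Y)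
        (fun e => if e ∈ D then U' e else splice (regionEdges w Y) U τ e)) ≤
      Real.exp (D.card * (Real.exp (12 * r.N * |β|) * ι)) *
        ∫ V, bcRatio r.ρ β (regionEdges w Y) σ τ V ∂(ymSpecification r.ρ β (innerEdges w Y) (splice (regionEdges w Y) U τ)) := by
  classical
  set y : ℝ := Real.exp (12 * r.N * |β|) * ι with hy
  induction D using Finset.induction_on with
  | empty => simp
  | @insert a D haD ih =>
    have hD' : D ⊆ cellEdges w 0 := fun e he => hD (Finset.mem_insert_of_mem he)
    have ha : a ∈ cellEdges w 0 := hD (Finset.mem_insert_self a D)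
    set ζ : LGConfig 4 G := fun e => if e ∈ D then U' e else splice (regionEdges w Y) U τ e with hζdef
    have hζ : ∀ e ∉ regionEdges w Y, ζ e = τ e := fun e he => by
      have heD : e ∉ D := fun heD => he (hY (hD' heD))
      simp only [hζdef, heD, if_false, splice_apply_not_mem _ _ _ he]
    have hupd : (fun e => if e ∈ insert a D then U' e else splice (regionEdges w Y) U τ e) = Function.update ζ a (U' a) := by
      funext e
      by_cases hea : e = a
      · subst hea; simp [hζdef]
      · rw [Function.update_of_ne hea]
        simp [hζdef, Finset.mem_insert, hea]
    rw [hupd, Finset.card_insert_of_notMem haD]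
    have hstep := inner_integral_update_le_of_influence G r hw hb hn hσ hζ ha (U' a) hι (hinfl a ha (U' a))
    refine hstep.trans ?_
    have hih := ih hD'
    have hye : 0 ≤ Real.exp y := (Real.exp_pos y).le
    calc Real.exp y * ∫ V, bcRatio r.ρ β (regionEdges w Y) σ τ V ∂(ymSpecification r.ρ β (innerEdges w Y) ζ)
        ≤ Real.exp y * (Real.exp (D.card * y) *
            ∫ V, bcRatio r.ρ β (regionEdges w Y) σ τ V ∂(ymSpecification r.ρ β (innerEdges w Y) (splice (regionEdges w Y) U τ))) :=
          mul_le_mul_of_nonneg_left hih hye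
      _ = Real.exp (((D.card + 1 : ℕ) : ℝ) * y) *
            ∫ V, bcRatio r.ρ β (regionEdges w Y) σ τ V ∂(ymSpecification r.ρ β (innerEdges w Y) (splice (regionEdges w Y) U τ)) := by
          rw [← mul_assoc, ← Real.exp_add]; congr 1; push_cast; ring

/-- **Centre-cell RATIO mixing from an influence bound.**  On a mesh-`b` frame (`b ≥ 1`), for a region `Y ∋ 0` of the `n`-window (`n ≥ 1`) and
data `σ` agreeing with `τ` on the window: an influence bound `ι` (uniform over the centre links and the updates) gives the multiplicative
oscillation `exp(64 b⁴ · e^{12N|β|} · ι)` of the centre-conditioned ratio. -/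
theorem centreRatio_le_exp_of_influence (hw : AfPincerUc.IsFrame b w) (hb : 1 ≤ b) (hn : 1 ≤ n) (h0 : (0 : Cell) ∈ Y)
    (hσ : σ ∈ WindowAgree w n Y τ) {ι : ℝ} (hι : 0 ≤ ι)
    (hinfl : ∀ a ∈ cellEdges w 0, ∀ x : G, ∀ ω η : LGConfig 4 G,
      (∀ z : ZdEdge 4, z ∉ innerEdges w Y → ⌊‖z.1 - a.1‖⌋₊ ≤ 2 * n * b → ω z = η z) →
      |(∫ V, linkRatio r.ρ β w Y a x V ∂(ymSpecification r.ρ β (innerEdges w Y) ω)) -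
          ∫ V, linkRatio r.ρ β w Y a x V ∂(ymSpecification r.ρ β (innerEdges w Y) η)| ≤ ι)
    (U U' : LGConfig 4 G) :
    centreRatio r.ρ β w Y σ τ U' ≤ Real.exp (64 * (b : ℝ) ^ 4 * (Real.exp (12 * r.N * |β|) * ι)) * centreRatio r.ρ β w Y σ τ U := by
  classical
  haveI := r.t2Space
  haveI := r.secondCountableTopology
  have hρ := r.continuous
  have hY : cellEdges w 0 ⊆ regionEdges w Y := Tempered.cellEdges_subset_regionEdges w h0
  set y : ℝ := Real.exp (12 * r.N * |β|) * ι with hy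
  have hsw := inner_integral_switch_le_of_influence G r hw hb hn hY hσ hι hinfl U U' (cellEdges w 0) subset_rfl
  have hcongr : ∫ V, bcRatio r.ρ β (regionEdges w Y) σ τ V ∂(ymSpecification r.ρ β (innerEdges w Y)
        (fun e => if e ∈ cellEdges w 0 then U' e else splice (regionEdges w Y) U τ e)) = centreRatio r.ρ β w Y σ τ U' := by
    unfold centreRatio
    refine integral_ymSpecification_congr_of_eqOn r.ρ hρ β (innerEdges w Y) (S := regionEdges w Y)
      (measurable_bcRatio r.ρ hρ β _ σ τ) (fun V V' h => bcRatio_eq_of_eqOn r.ρ β _ σ τ fun e he => h e (Finset.mem_coe.2 he))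
      fun e he _ => ?_
    by_cases hec : e ∈ cellEdges w 0
    · simp only [hec, if_true, splice_apply_mem _ _ _ (hY hec)]
    · simp only [hec, if_false]
      have heΛ : e ∉ regionEdges w Y := fun heΛ => he (Finset.mem_sdiff.2 ⟨heΛ, hec⟩)
      rw [splice_apply_not_mem _ _ _ heΛ, splice_apply_not_mem _ _ _ heΛ]
  rw [hcongr] at hsw
  refine hsw.trans (mul_le_mul_of_nonneg_right ?_ (centreRatio_pos hρ β w Y σ τ U).le)
  refine Real.exp_le_exp.2 ?_
  have hcard : ((cellEdges w 0).card : ℝ) ≤ 64 * (b : ℝ) ^ 4 := by exact_mod_cast card_cellEdges_le_mesh hw 0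
  have hy0 : 0 ≤ y := by positivity
  exact mul_le_mul_of_nonneg_right hcard hy0

/-- **The class of record at mesh `b`, window `n`, from a uniform influence bound `ι ≥ 0`** (uniform over mesh-`b` frames, regions `Y ∋ 0` of the
`n`-window, centre links and updates): `BlockedActivityClassW r.ρ β b n (exp(64 b⁴ e^{12N|β|} ι) − 1)`. -/
theorem blockedActivityClassW_of_influence {ι : ℝ} (hι : 0 ≤ ι) (hb : 1 ≤ b) (hn : 1 ≤ n)
    (hinfl : ∀ w : Fin 4 → ℤ → ℤ, AfPincerUc.IsFrame b w → ∀ Y : Finset Cell, Y ⊆ windowCells n → (0 : Cell) ∈ Y →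
      ∀ a ∈ cellEdges w 0, ∀ x : G, ∀ ω η : LGConfig 4 G,
      (∀ z : ZdEdge 4, z ∉ innerEdges w Y → ⌊‖z.1 - a.1‖⌋₊ ≤ 2 * n * b → ω z = η z) →
      |(∫ V, linkRatio r.ρ β w Y a x V ∂(ymSpecification r.ρ β (innerEdges w Y) ω)) -
          ∫ V, linkRatio r.ρ β w Y a x V ∂(ymSpecification r.ρ β (innerEdges w Y) η)| ≤ ι) :
    BlockedActivityClassW r.ρ β b n (Real.exp (64 * (b : ℝ) ^ 4 * (Real.exp (12 * r.N * |β|) * ι)) - 1) := by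
  haveI := r.t2Space
  haveI := r.secondCountableTopology
  exact blockedActivityClassW_of_centreRatio_le r.continuous (by positivity)
    fun w hw Y hY h0 τ σ hσ U U' => centreRatio_le_exp_of_influence G r hw hb hn h0 hσ hι (hinfl w hw Y hY h0) U' U

/-- **RATIO clause (i) from a uniform influence bound**, for EVERY `Typ` (typicality is not used). -/
theorem ratioClauseI_of_influence {ι : ℝ} (hι : 0 ≤ ι) (hw : AfPincerUc.IsFrame b w) (hb : 1 ≤ b) (hn : 1 ≤ n)
    (hinfl : ∀ Y : Finset Cell, Y ⊆ windowCells n → (0 : Cell) ∈ Y →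
      ∀ a ∈ cellEdges w 0, ∀ x : G, ∀ ω η : LGConfig 4 G,
      (∀ z : ZdEdge 4, z ∉ innerEdges w Y → ⌊‖z.1 - a.1‖⌋₊ ≤ 2 * n * b → ω z = η z) →
      |(∫ V, linkRatio r.ρ β w Y a x V ∂(ymSpecification r.ρ β (innerEdges w Y) ω)) -
          ∫ V, linkRatio r.ρ β w Y a x V ∂(ymSpecification r.ρ β (innerEdges w Y) η)| ≤ ι)
    (Typ : Cell → Set (LGConfig 4 G)) :
    RatioClauseI r.ρ β w n (64 * (b : ℝ) ^ 4 * (Real.exp (12 * r.N * |β|) * ι)) Typ :=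
  fun _ hY h0 _ _ _ _ hσ' U U' => centreRatio_le_exp_of_influence G r hw hb hn h0 hσ' hι (hinfl _ hY h0) U' U

end Step

/-! ## §2 Every compact `G`: the rows on the SHARP window `18·N·|β| ≤ q < 1` -/

section Sharp

variable (G : Type) [Group G] [TopologicalSpace G] [IsTopologicalGroup G] [CompactSpace G] [MeasurableSpace G] [BorelSpace G]
  (r : Literature.MathematicalPhysics.QuantumFieldTheory.LatticeRep G)

/-- **THE NUMBER of this file**: the activity radius reached at mesh `b`, window `n`, Dobrushin rate `q`:
`meshRadiusKR N β q b n = exp(3072 · b⁴ · e^{24N|β|} · q^{2nb}) − 1` (`3072 = 64 · 48`; g3's `meshRadiusSC N β b n` is `q = 1/2`). -/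
def meshRadiusKR (N : ℕ) (β q : ℝ) (b n : ℕ) : ℝ :=
  Real.exp (3072 * (b : ℝ) ^ 4 * Real.exp (24 * N * |β|) * q ^ (2 * n * b)) - 1

/-- `meshRadiusKR N β (1/2) b n = meshRadiusSC N β b n`. -/
theorem meshRadiusKR_half (N : ℕ) (β : ℝ) (b n : ℕ) : meshRadiusKR N β (1 / 2) b n = meshRadiusSC N β b n := rfl

/-- **The influence bound of the sharp every-group door for the link ratio**: on a mesh-`b` frame (`b, n ≥ 1`), for `18·N·|β| ≤ q`, `0 < q < 1`,
any region `Y`, centre link `a` and `x`: exteriors agreeing on the exterior links within sup-distance `2nb` of `a` give inner-kernel averages of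
`linkRatio … a x` within `48 · e^{12N|β|} · q^{2nb}` (`|E| ≤ e^{12N|β|}`, `E` reads the `≤ 24` links of the plaquettes through `a`). -/
theorem linkRatio_influence_sharp {β q : ℝ} (hq0 : 0 < q) (hq1 : q < 1) (hβ : 18 * (r.N : ℝ) * |β| ≤ q) (w : Fin 4 → ℤ → ℤ) (b n : ℕ)
    (Y : Finset Cell) (a : ZdEdge 4) (x : G) (ω η : LGConfig 4 G)
    (hagree : ∀ z : ZdEdge 4, z ∉ innerEdges w Y → ⌊‖z.1 - a.1‖⌋₊ ≤ 2 * n * b → ω z = η z) :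
    |(∫ V, linkRatio r.ρ β w Y a x V ∂(ymSpecification r.ρ β (innerEdges w Y) ω)) -
        ∫ V, linkRatio r.ρ β w Y a x V ∂(ymSpecification r.ρ β (innerEdges w Y) η)| ≤
      48 * Real.exp (12 * r.N * |β|) * q ^ (2 * n * b) := by
  haveI := r.t2Space
  haveI := r.secondCountableTopology
  have hρ := r.continuous
  set c : ℝ := 12 * r.N * |β| with hc
  have hEb : ∀ V, Real.exp (-c) ≤ linkRatio r.ρ β w Y a x V ∧ linkRatio r.ρ β w Y a x V ≤ Real.exp c := fun V =>
    linkRatio_bounds G r a x V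
  have hEm : Measurable (linkRatio r.ρ β w Y a x) := by
    refine (Real.continuous_exp.comp (continuous_const.mul ?_)).measurable
    exact ((continuous_wilsonBoundaryAction r.ρ hρ (innerEdges w Y)).comp (continuous_id.update a continuous_const)).sub
      (continuous_wilsonBoundaryAction r.ρ hρ (innerEdges w Y))
  have h := KRInfluence.abs_kerInt_sub_le_of_agree_ball_sharp G r hq0 hq1 hβ (innerEdges w Y) ω η a.1 (2 * n * b) hagree hEm
    (dependsOn_linkRatio r.ρ β a x) (M := Real.exp c)
    (fun V => by rw [abs_of_pos ((Real.exp_pos _).trans_le (hEb V).1)]; exact (hEb V).2)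
    (ρ₀ := 1) (fun z hz => floor_norm_le_one_of_mem_plaqNbhd hz)
  refine h.trans ?_
  have hcard : (((plaquettesTouching ({a} : Finset (ZdEdge 4))).biUnion plaquetteEdges).card : ℝ) ≤ 24 := by
    exact_mod_cast card_plaqNbhd_le a
  have hexp : q ^ (2 * n * b + 1 - 1) = q ^ (2 * n * b) := by rw [Nat.add_sub_cancel]
  rw [hexp]
  have h0 : 0 ≤ 2 * Real.exp c * q ^ (2 * n * b) := by positivity
  nlinarith

/-- **STRONG COUPLING AFTER BLOCKING on the SHARP window — the W-class of record at EVERY mesh.**  For every compact `G`, every lattice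
representation `r` (`N = r.N`), every `β, q` with `18·N·|β| ≤ q`, `0 < q < 1`, every mesh `b ≥ 1` and window `n ≥ 1`:
`BlockedActivityClassW r.ρ β b n (meshRadiusKR r.N β q b n)`. -/
theorem blockedActivityClassW_strongCoupling_mesh_sharp {β q : ℝ} (hq0 : 0 < q) (hq1 : q < 1) (hβ : 18 * (r.N : ℝ) * |β| ≤ q) {b n : ℕ}
    (hb : 1 ≤ b) (hn : 1 ≤ n) : BlockedActivityClassW r.ρ β b n (meshRadiusKR r.N β q b n) := by
  have h := blockedActivityClassW_of_influence G r (ι := 48 * Real.exp (12 * r.N * |β|) * q ^ (2 * n * b)) (by positivity) hb hn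
    fun w _ Y _ _ a _ x ω η hag => linkRatio_influence_sharp G r hq0 hq1 hβ w b n Y a x ω η hag
  have heq : Real.exp (64 * (b : ℝ) ^ 4 * (Real.exp (12 * r.N * |β|) * (48 * Real.exp (12 * r.N * |β|) * q ^ (2 * n * b)))) - 1 =
      meshRadiusKR r.N β q b n := by
    unfold meshRadiusKR
    congr 2
    have h2c : Real.exp (12 * r.N * |β|) * Real.exp (12 * r.N * |β|) = Real.exp (24 * r.N * |β|) := by
      rw [← Real.exp_add]; congr 1; ring
    calc 64 * (b : ℝ) ^ 4 * (Real.exp (12 * r.N * |β|) * (48 * Real.exp (12 * r.N * |β|) * q ^ (2 * n * b)))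
        = 3072 * (b : ℝ) ^ 4 * (Real.exp (12 * r.N * |β|) * Real.exp (12 * r.N * |β|)) * q ^ (2 * n * b) := by ring
      _ = 3072 * (b : ℝ) ^ 4 * Real.exp (24 * r.N * |β|) * q ^ (2 * n * b) := by rw [h2c]
  rw [heq] at h
  exact h

/-- The case `q = 1/2`: g3's radius `meshRadiusSC` at every mesh on the SIX TIMES WIDER window `36·N·|β| ≤ 1` (g3: `216·N·|β| ≤ 1`). -/
theorem blockedActivityClassW_strongCoupling_mesh_36 {β : ℝ} (hβ : 36 * (r.N : ℝ) * |β| ≤ 1) {b n : ℕ} (hb : 1 ≤ b) (hn : 1 ≤ n) :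
    BlockedActivityClassW r.ρ β b n (meshRadiusSC r.N β b n) := by
  rw [← meshRadiusKR_half]
  exact blockedActivityClassW_strongCoupling_mesh_sharp G r (by norm_num) (by norm_num) (by linarith) hb hn

/-- … hence the W|Typ class at every frame for EVERY class `Typ`, and at every centre, on the sharp window. -/
theorem blockedActivityTypWAll_strongCoupling_mesh_sharp {β q : ℝ} (hq0 : 0 < q) (hq1 : q < 1) (hβ : 18 * (r.N : ℝ) * |β| ≤ q)
    {b n : ℕ} (hb : 1 ≤ b) (hn : 1 ≤ n) {w : Fin 4 → ℤ → ℤ} (hw : AfPincerUc.IsFrame b w) (Typ : Cell → Set (LGConfig 4 G)) :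
    BlockedActivityTypWAll r.ρ β w n (meshRadiusKR r.N β q b n) Typ := fun c₀ =>
  blockedActivityTypW_of_blockedActivityClassW (blockedActivityClassW_strongCoupling_mesh_sharp G r hq0 hq1 hβ hb hn) (shiftFrame_mesh hw c₀) _

/-- **RATIO clause (i) on the sharp window, every mesh, every class**: `RatioClauseI r.ρ β w n (3072 b⁴ e^{24N|β|} q^{2nb}) Typ`. -/
theorem ratioClauseI_strongCoupling_sharp {β q : ℝ} (hq0 : 0 < q) (hq1 : q < 1) (hβ : 18 * (r.N : ℝ) * |β| ≤ q)
    {w : Fin 4 → ℤ → ℤ} {b n : ℕ} (hw : AfPincerUc.IsFrame b w) (hb : 1 ≤ b) (hn : 1 ≤ n) (Typ : Cell → Set (LGConfig 4 G)) :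
    RatioClauseI r.ρ β w n (3072 * (b : ℝ) ^ 4 * Real.exp (24 * r.N * |β|) * q ^ (2 * n * b)) Typ := by
  have h := ratioClauseI_of_influence G r (ι := 48 * Real.exp (12 * r.N * |β|) * q ^ (2 * n * b)) (by positivity) hw hb hn
    (fun Y _ _ a _ x ω η hag => linkRatio_influence_sharp G r hq0 hq1 hβ w b n Y a x ω η hag) Typ
  have h2c : Real.exp (12 * r.N * |β|) * Real.exp (12 * r.N * |β|) = Real.exp (24 * r.N * |β|) := by
    rw [← Real.exp_add]; congr 1; ring
  have heq : 64 * (b : ℝ) ^ 4 * (Real.exp (12 * r.N * |β|) * (48 * Real.exp (12 * r.N * |β|) * q ^ (2 * n * b))) =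
      3072 * (b : ℝ) ^ 4 * Real.exp (24 * r.N * |β|) * q ^ (2 * n * b) := by
    calc 64 * (b : ℝ) ^ 4 * (Real.exp (12 * r.N * |β|) * (48 * Real.exp (12 * r.N * |β|) * q ^ (2 * n * b)))
        = 3072 * (b : ℝ) ^ 4 * (Real.exp (12 * r.N * |β|) * Real.exp (12 * r.N * |β|)) * q ^ (2 * n * b) := by ring
      _ = 3072 * (b : ℝ) ^ 4 * Real.exp (24 * r.N * |β|) * q ^ (2 * n * b) := by rw [h2c]
  rw [heq] at h
  exact h

end Sharp

end Summit.QuantumFields.YangMills.Cruxes.IR.BlockedActivity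

end
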